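import Literature.AlgebraicGeometry.AbelianSchemes.SerreTensorUntwistBaseChange
import HarnessLib

/-!
# `F0P6aSpecialFibrePointsRows` — the (C3a) level row READ ON SPECIAL-FIBRE POINTS (L2 column, head-room cure helper for ★ `Theorems/F0P6aSpecOrgansTTranslReduction.lean`)

ONE generic theorem, `map_eq_of_pow_rows_fibrePoints`: the elementary level-row step «`τ ≫ r₁ = σ₁^{N′}`, `τ ≫ r₂ = σ₂^{N′}`, `r₁ ≫ ε = r₂`,
`σᵢ` `N`-torsion, `gcd(N′, N) = 1` ⟹ `ε(σ₁) = σ₂`» (★ `comp_eq_of_pow_rows` of `F0P6aSpecOrgansTTranslReduction`, morphism currency) with every carrier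
spelled in the POINTS currency its caller (C3α) `red₀Of_eq_of_common_source₀` actually holds: the common source `A` (an abelian `Spec Ω`-scheme, points
`A.toAffine.toAbelianVariety.Points Ω`), the two targets `𝒜.baseChange xᵢ` for the morphisms and `(𝒜.fibre xᵢ).toAbelianVariety.Points Ω` for the points
(`AbelianVariety.Points`, Mathlib's `Hom.commGroup` law), `AlgPoints.map` for composition.  WHY A SEPARATE HEAD: read through `AlgPoints.map r P = P ≫ r` and
`(𝒜.fibre x).toAbelianVariety.X = (𝒜.baseChange x).X` (both `rfl`), the `Points` power and the `Hom.monoid` power agree only after unfolding the two instance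
towers; done HERE the unfolding runs on variables (cheap), done at the caller it ran on the dock-sized carriers `sch₀Of ∕ fibre₀Of … (red₀Of …)` (154 k heartbeat
units measured by import, LA2-p04 (g8) probes `C3a.probe.v1…v4`).  No new mathematics; proof = Bezout on exponents (★ `eq_of_pow_eq_pow_of_coprime`) after
`MonObj.pow_comp`.  HC_CM is proved only modulo the 7 printed citations (2 remaining: hLiu418 = stmt-HodgeConjecture-24832, h413 = stmt-HodgeConjecture-24833)
until rung 0 closes; a head-room cure is count-neutral.
-/

set_option autoImplicit false
set_option linter.dupNamespace false

noncomputable section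

universe u

namespace Summit.HodgeConjecture.HodgeConjecture.Cruxes.HLiu418.F0P6aLineSpecialisation

open CategoryTheory AlgebraicGeometry
open scoped MonObj
open Literature.AlgebraicGeometry.Motives (AlgPoints)
open Literature.AlgebraicGeometry.AbelianSchemes Literature.AlgebraicGeometry.AbelianSchemes.AbelianSchemeOver

/-- (C3a-pts) **The level row READ ON SPECIAL-FIBRE POINTS.**  Let `𝒜 → T` be an abelian scheme, `x₁ x₂ : Spec Ω → T` two field-valued points, `A` an abelian
`Spec Ω`-scheme, `rᵢ : A → 𝒜 ×_T xᵢ` and `ε : 𝒜 ×_T x₁ → 𝒜 ×_T x₂` a homomorphism with `r₁ ≫ ε = r₂`; let `τ ∈ A(Ω)` and `σᵢ ∈ 𝒜_{xᵢ}(Ω)` with `rᵢ(τ) = σᵢ^{N′}`,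
`σᵢ^N = 1` and `gcd(N′, N) = 1`.  Then `ε(σ₁) = σ₂`.  (`(σ₁ ≫ ε)^{N′} = σ₁^{N′} ≫ ε = τ ≫ r₂ = σ₂^{N′}` by Mathlib `MonObj.pow_comp`, then Bezout on the exponents,
★ `eq_of_pow_eq_pow_of_coprime`; the `Points` group law and the `Hom.monoid` law on `Spec Ω ⟶ 𝒜 ×_T xᵢ` agree definitionally.)
[cite: MumfordFogartyKirwan1994, Ch. 7 §2 Definition 7.3 (p. 130)] -/
theorem map_eq_of_pow_rows_fibrePoints {Ω : Type u} [Field Ω] {T : Scheme.{u}} (𝒜 : AbelianSchemeOver T) (x₁ x₂ : Spec (.of Ω) ⟶ T)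
    {A : AbelianSchemeOver (Spec (.of Ω))}
    (r₁ : A.X ⟶ (𝒜.baseChange x₁).X) (r₂ : A.X ⟶ (𝒜.baseChange x₂).X) (ε : (𝒜.baseChange x₁).X ⟶ (𝒜.baseChange x₂).X) [IsMonHom ε]
    (hε : r₁ ≫ ε = r₂) (τ : A.toAffine.toAbelianVariety.Points Ω)
    {σ₁ : (𝒜.fibre x₁).toAbelianVariety.Points Ω} {σ₂ : (𝒜.fibre x₂).toAbelianVariety.Points Ω} {N' N : ℕ} (hcop : N'.Coprime N)
    (h₁ : (AlgPoints.map r₁ τ : (𝒜.fibre x₁).toAbelianVariety.Points Ω) = σ₁ ^ N')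
    (h₂ : (AlgPoints.map r₂ τ : (𝒜.fibre x₂).toAbelianVariety.Points Ω) = σ₂ ^ N')
    (hσ₁ : σ₁ ^ N = 1) (hσ₂ : σ₂ ^ N = 1) :
    (AlgPoints.map ε σ₁ : (𝒜.fibre x₂).toAbelianVariety.Points Ω) = σ₂ := by
  -- ★ `comp_eq_of_pow_rows` (morphism currency: `(u₁ ≫ e)^{N′} = u₁^{N′} ≫ e = t ≫ s₂ = u₂^{N′}` by Mathlib `MonObj.pow_comp`, `(u₁ ≫ e)^N = 1`, then
  -- Bezout on the exponents, ★ `eq_of_pow_eq_pow_of_coprime`), kept LOCAL so that this file stays upstream of `F0P6aSpecOrgansTTranslReduction`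
  have key : ∀ {U X₁ X₂ : Over (Spec (.of Ω))} [MonObj X₁] [MonObj X₂] (s₁ : A.X ⟶ X₁) (s₂ : A.X ⟶ X₂) (e : X₁ ⟶ X₂) [IsMonHom e],
      s₁ ≫ e = s₂ → ∀ {t : U ⟶ A.X} {u₁ : U ⟶ X₁} {u₂ : U ⟶ X₂} {n m : ℕ}, n.Coprime m →
        t ≫ s₁ = u₁ ^ n → t ≫ s₂ = u₂ ^ n → u₁ ^ m = 1 → u₂ ^ m = 1 → u₁ ≫ e = u₂ := by
    intro U X₁ X₂ _ _ s₁ s₂ e _ he t u₁ u₂ n m hnm ht₁ ht₂ hu₁ hu₂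
    have hpow : (u₁ ≫ e) ^ n = u₂ ^ n := by rw [← MonObj.pow_comp, ← ht₁, Category.assoc, he, ht₂]
    have htors : (u₁ ≫ e) ^ m = 1 := by rw [← MonObj.pow_comp, hu₁, MonObj.one_comp]
    exact eq_of_pow_eq_pow_of_coprime hnm hpow htors hu₂
  -- the POINTS rows ARE morphism rows: `AlgPoints.map r P = P ≫ r`, `(𝒜.fibre x).toAbelianVariety.X = (𝒜.baseChange x).X` and the `Points` law =
  -- Mathlib's `Hom.commGroup` law, all definitionally — unfolded here on variables (cheap), not at the callers on dock-sized carriers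
  exact key r₁ r₂ ε hε hcop h₁ h₂ hσ₁ hσ₂

end Summit.HodgeConjecture.HodgeConjecture.Cruxes.HLiu418.F0P6aLineSpecialisation

end
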